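import Summits.QuantumFields.BalabanUV.Beta.CompositeCorrectorKernelSpr
import Summits.QuantumFields.BalabanUV.Beta.SymCorrectorSlot

/-!
# `BalabanUV.Beta.CompositeCorrectorSlot` — binder row D1 (OWNER an2), SPEC S-an2-g49-1 §1 (B3) ∕ FILE F1: **THE SLOT ADJUNCTION FOR THE COMPOSITE CORRECTOR
# `Ψ̂_m = psiK r L m` OF K-U3d** — `vertexOfK (Ψ̂_m ∘ K ∘ Ψ̂_mᵀ) N S μ y = vertexOfK K N (slotPsiF r L m S) μ y` for every spread `K`, every local stencil family `S`,
# every blocking `N`, with the transported family `slotPsiF` a local stencil family again ([S] socket) — the composite twin of leaf-03's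
# `SymCorrectorSlot.vertexOfK_conj_psiKS` (one level, symmetrised corrector)

WHY (S-an2-g49-1 §1, the located constraint on (L2′) `hN`).  `TshotOf Lc Jc m = hessKer (KInv (Lc^m)) (vertexOf (Jc m).S) (Jc m).W` hard-wires the STRAIGHT chart, while
the N∕F one-shot charts of record are K-U3d's `Ψ̂_m ∘ coDressKBmAt ρ (Lc^m) (KInv (Lc^m)) ∘ Ψ̂_mᵀ` (`CompositeOneShotChart`, W-an2-g48-3).  Of the three bridges that carry
`hessKer` from the composite chart to the straight one, (B1) d1-p2's `HessKerConjugation.hessKer_conj_kernel` and (B2) `AxialDressingRootedBmHessian.hessKer_dressBmAt` are in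
the tree; THIS FILE is (B3): the chain-rule vertex through the conjugated kernel IS the vertex through `K` of the SLOT-TRANSPORTED stencil family — so the composite
tables `(JcComp m).S` are `slotPsiF r Lc m` of the raw ones (then dressed), and the [S] socket of `JetData` is served by `locStencil_slotPsiF`.

CONTENT ([folklore] unless marked; `0 < L`, roots `r k ∈ box (d+1) L` at every level, `m` levels, `n = L^m`; `Ψ̂_m = psiK r L m` — K-U3d L2 `CompositeCorrectorKernel(Spr)`).
* §1 [our object] **`slotPsi r L m T β x := Σ_l Σ'_u Ψ̂_m((u, inl l), (x, inl β)) · T l u`** — the ADJOINT action of `Ψ_m` on a scalar bond family (`= ⟨Ψ_m e_{(β,x)}, T⟩`);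
  [our object] **`slotPsiF r L m S`** (the same on a kernel-valued family, read entrywise; `slotPsiF_apply` is `rfl`); `slotPsi_zero`.
* §2 ROW-FINITENESS: `psiK_inl_inl_eq_zero_of_far` (the entry vanishes once ONE coordinate of `u − x` leaves `[−n, n]` — K-U3d's range-`0` letter
  `psiK_eq_idK_of_blk_ne`), `summable_psiK_mul` (hence every slot series against an ARBITRARY family is a finite sum).
* §3 LEG ACTIONS OF `Ψ̂_mᵀ` (no hypothesis on `X`): **`comp_trK_psiK_inl_left : (Ψ̂_mᵀ ∘ X)(x, w)_{inl β, b} = slotPsi (κ u ↦ X(u, w)_{inl κ, b}) β x`**, `comp_trK_psiK_inr_left`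
  (multiplier rows picked); **`comp_trK_psiK_colK : Ψ̂_mᵀ ∘ colK T w₀ b₀ = colK (slotPsi T) w₀ b₀`** (leaf-03's column kernel `SymCorrectorSlot.colK`, BY NAME).
* §4 BOUNDS: `abs_slotPsi_le_of_bounded` (bounded families stay bounded: `(d+1)·C_Ψ·Zl δ·B` from `Decays Ψ̂_m C_Ψ δ`), **`locStencil_slotPsiF`** — THE [S] SOCKET: a local
  stencil family transports to a local stencil family (`biLoc_wsum` with the decaying column of `Ψ̂_m` as weights).
* §5 **`vertexOfK_conj_psiK_apply`**, **`vertexOfK_conj_psiK`** (THE SLOT ADJUNCTION, any blocking `N` of the vertex), **`colH_conj_psiK`** (the (T-col) half: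
  `colH (Ψ̂_m∘K∘Ψ̂_mᵀ) N μ y = Ψ_m (colH K N μ y)` — K-U3d's apply bridges `comp_trK_psiK_inr ∕ comp_psiK_inl`).
HOW.  §5 is ASSOCIATIVITY exactly as leaf-03's §4 (`vertexOfK_eq_comp_trK_colK`, `trK_conj`, an5's `comp_assoc_tame`, K-U3d `comp_psiK_inr`, §3), no Fubini.
WHAT THIS IS NOT: not the dressing (B2), not `tabsComp`'s packaging, not (L2′) `hN`; nothing of Bałaban's asserted; 0 estimates; 0∕4 row-D1 binders (hW, hR, D1Tel, D1Rep);
NOT (C1), NOT (T-ID), NOT D1, NEVER «G-an2-4 closed», NOT BetaPertH, NOT continuum, NOT Clay.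

HONEST DEPENDENCY (page 1, mandatory): continuum YM on T⁴ ⇐ BetaPertH ∧ nine spine estimates (0/9 proved); BetaPertH ⇐ (D1) ∧ (D4) ∧ CAP+tail;
G-an2-4 gates asym, D1 and NE2/3/4.  HONEST FRAMING (cell contract, verbatim): «discharging `BetaPertH` makes Bałaban's UV stability UNCONDITIONAL —
a real constructive-QFT result; it is NOT the continuum limit and NOT the Clay problem.»  ABSOLUTE RULE (cell charter, verbatim): «No internally-minted
statement may enter as a cited fact. Every hypothesis is either kernel-proved in this package or a verbatim quotation of a PUBLISHED theorem with page
reference. The manuscript(s) under audit are NOT citable for their own disputed steps — they are the thing under adjudication; programme-internal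
(2001/route/tribunal) claims are never citable.»  Two [our object] bookkeeping definitions (`slotPsi`, `slotPsiF`: the adjoint action of an existing linear map, asserting
nothing) + [folklore] finite-sum ∕ absolutely-convergent-sum bookkeeping over the cell's OWN typed objects BY NAME; no `def … : Prop`, nothing cited, 0 sorry.
Row D1 OWNER an2 (b2b-balaban-beta-an2) gen 49, 2026-08-23.  No existing file touched.
-/

noncomputable section

namespace Summit.QuantumFields.BalabanUV.Beta.CompositeCorrectorSlot

open Finset
open scoped BigOperators
open Literature.MathematicalPhysics.QuantumFieldTheory
open Literature.MathematicalPhysics.QuantumFieldTheory.Balaban1983to89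
open Literature.MathematicalPhysics.QuantumFieldTheory.Balaban1983to89.Beta
open B12Sec2to5 (l1 l1_nonneg)
open ExpKernelCalculus (MKer Decays BiLoc comp Zl summable_exp_shift' tsum_exp_shift')
open OneStepResolventKernel (Fib wsum LocStencil biLoc_wsum biLoc_finset_sum)
open OneStepKernelFamily (colH vertexOfK)
open AffineAveraging (Site Form1 box toSite unitVec unitVec_apply)
open AveragingContours (blk)
open HessKerSchurResolvent (idK idK_apply)
open Summit.QuantumFields.BalabanUV.Beta.TameKernelCalculus (Spr Loc trK trK_apply comp_assoc_tame Spr.tame Loc.tame Spr.trK decays_of_le biLoc_of_le)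
open Summit.QuantumFields.BalabanUV.Beta.ChartConjugationRelative (spr_comp)
open Summit.QuantumFields.BalabanUV.Beta.AxialDressingRooted (tsum_point tsum_point')
open Summit.QuantumFields.BalabanUV.Beta.CompositeCorrectorForms (corrPsi)
open Summit.QuantumFields.BalabanUV.Beta.CompositeCorrectorLocality (le_of_blk lt_of_blk)
open Summit.QuantumFields.BalabanUV.Beta.CompositeCorrectorKernel (psiK psiK_inl_inl psiK_inl_inr psiK_inr_inl psiK_inr_inr psiK_eq_idK_of_blk_ne comp_psiK_inl
  comp_psiK_inr comp_trK_psiK_inr decays_psiK spr_psiK)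
open Summit.QuantumFields.BalabanUV.Beta.SymCorrectorSlot (colK colK_apply_self colK_inr colK_of_ne loc_colK vertexOfK_eq_comp_trK_colK trK_conj abs_stencil_le_exp_left)

variable {d : ℕ}

/-! ## §1 The slot transport by `Ψ̂_mᵀ` -/

section Defs

variable (r : ℕ → (Fin (d + 1) → ℕ)) (L m : ℕ)

/-- [our object — the adjoint action of K-U3d's `Ψ_m` on the slot index, asserting nothing] **THE SLOT TRANSPORT OF A SCALAR BOND FAMILY**:
`slotPsi r L m T β x := Σ_l Σ'_u Ψ̂_m((u, inl l), (x, inl β)) · T l u` (`Ψ̂_m((u, inl l), (x, inl β)) = (Ψ_m e_{(β,x)})_l(u)`, `psiK_inl_inl`). -/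
def slotPsi (T : Form1 (d + 1) ℝ) : Form1 (d + 1) ℝ :=
  fun β x => ∑ l : Fin (d + 1), ∑' u : Site (d + 1), psiK r L m u x (Sum.inl l) (Sum.inl β) * T l u

/-- [our object] **THE SLOT TRANSPORT OF A KERNEL-VALUED STENCIL FAMILY**, entry by entry. -/
def slotPsiF (S : Fin (d + 1) → Site (d + 1) → MKer (d + 1) (Fib d)) : Fin (d + 1) → Site (d + 1) → MKer (d + 1) (Fib d) :=
  fun κ u x z a b => slotPsi r L m (fun κ' u' => S κ' u' x z a b) κ u

/-- [folklore] `slotPsiF` read at an entry is `slotPsi` of the scalar family read there (`rfl`). -/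
theorem slotPsiF_apply (S : Fin (d + 1) → Site (d + 1) → MKer (d + 1) (Fib d)) (κ : Fin (d + 1)) (u x z : Site (d + 1)) (a b : Fib d) :
    slotPsiF r L m S κ u x z a b = slotPsi r L m (fun κ' u' => S κ' u' x z a b) κ u := rfl

/-- [folklore] The slot transport of the zero family vanishes. -/
@[simp] theorem slotPsi_zero : slotPsi r L m (0 : Form1 (d + 1) ℝ) = 0 := by
  funext β x
  simp [slotPsi]

/-- [folklore] `slotPsiF` as a finite sum of weighted superpositions (`wsum`) — the shape of `biLoc_wsum`. -/
theorem slotPsiF_eq_sum_wsum (S : Fin (d + 1) → Site (d + 1) → MKer (d + 1) (Fib d)) (κ : Fin (d + 1)) (u : Site (d + 1)) :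
    slotPsiF r L m S κ u = fun x z a b => ∑ l : Fin (d + 1), wsum (fun u' => psiK r L m u' u (Sum.inl l) (Sum.inl κ)) (S l) x z a b := by
  funext x z a b
  rfl

end Defs

/-! ## §2 Row-finiteness of `Ψ̂_m` in the slot direction -/

section Finite

variable {L : ℕ} (hL : 0 < L) {r : ℕ → (Fin (d + 1) → ℕ)} (hr : ∀ k, r k ∈ box (d + 1) L) (m : ℕ)
include hL hr

/-- [folklore] **THE SLOT ENTRY VANISHES FAR FROM THE INPUT BOND**: if one coordinate of `u` lies outside `[x_j − n, x_j + n]` (`n = L^m`), then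
`Ψ̂_m((u, inl l), (x, inl β)) = 0` (K-U3d's range-`0` letter `psiK_eq_idK_of_blk_ne`: the blocks of `u` and of every `u + e_α` differ from the block of `x`). -/
theorem psiK_inl_inl_eq_zero_of_far {u x : Site (d + 1)} {j : Fin (d + 1)} (hj : u j < x j - (L ^ m : ℕ) ∨ x j + (L ^ m : ℕ) < u j)
    (l β : Fin (d + 1)) : psiK r L m u x (Sum.inl l) (Sum.inl β) = 0 := by
  have hn : 0 < L ^ m := pow_pos hL m
  have hux : u ≠ x := by
    rintro rfl
    rcases hj with h | h <;> omega
  have h1 : blk (L ^ m) x ≠ blk (L ^ m) u := by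
    intro h
    have a1 := le_of_blk hn x j
    have a2 := lt_of_blk hn x j
    have b1 := le_of_blk hn u j
    have b2 := lt_of_blk hn u j
    rw [h] at a1 a2
    rcases hj with h' | h' <;> omega
  have h2 : ∀ α : Fin (d + 1), blk (L ^ m) x ≠ blk (L ^ m) (u + unitVec α) := by
    intro α h
    have a1 := le_of_blk hn x j
    have a2 := lt_of_blk hn x j
    have b1 := le_of_blk hn (u + unitVec α) j
    have b2 := lt_of_blk hn (u + unitVec α) j
    rw [h] at a1 a2
    have e : (u + unitVec α) j = u j + (if j = α then 1 else 0) := by rw [Pi.add_apply, unitVec_apply]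
    rw [e] at b1 b2
    rcases hj with h' | h' <;> split_ifs at b1 b2 <;> omega
  rw [psiK_eq_idK_of_blk_ne hL hr m h1 h2, idK_apply, if_neg (fun h => hux h.1)]

/-- [folklore] **EVERY SLOT SERIES IS A FINITE SUM**: `u ↦ Ψ̂_m((u, inl l), (x, inl β)) · X u` is summable for an ARBITRARY `X` (finitely supported). -/
theorem summable_psiK_mul (X : Site (d + 1) → ℝ) (x : Site (d + 1)) (l β : Fin (d + 1)) :
    Summable fun u : Site (d + 1) => psiK r L m u x (Sum.inl l) (Sum.inl β) * X u := by
  refine summable_of_ne_finset_zero (s := Fintype.piFinset fun j : Fin (d + 1) => Finset.Icc (x j - (L ^ m : ℕ)) (x j + (L ^ m : ℕ))) fun u hu => ?_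
  rw [Fintype.mem_piFinset] at hu
  obtain ⟨j, hj⟩ := not_forall.mp hu
  rw [Finset.mem_Icc, not_and_or, not_le, not_le] at hj
  rw [psiK_inl_inl_eq_zero_of_far hL hr m hj, zero_mul]

end Finite

/-! ## §3 The leg actions of `Ψ̂_mᵀ` on an arbitrary kernel; the column kernel -/

section Legs

variable {L : ℕ} (hL : 0 < L) {r : ℕ → (Fin (d + 1) → ℕ)} (hr : ∀ k, r k ∈ box (d + 1) L) (m : ℕ)
include hL hr

/-- [folklore] **LEFT FIELD LEG: `(Ψ̂_mᵀ ∘ X)(x, w)_{inl β, b} = slotPsi r L m (κ u ↦ X(u, w)_{inl κ, b}) β x`** — ANY kernel `X` (the slot series is a finite sum, §2). -/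
theorem comp_trK_psiK_inl_left (X : MKer (d + 1) (Fib d)) (x w : Site (d + 1)) (β : Fin (d + 1)) (b : Fib d) :
    comp (trK (psiK r L m)) X x w (Sum.inl β) b = slotPsi r L m (fun κ u => X u w (Sum.inl κ) b) β x := by
  unfold ExpKernelCalculus.comp slotPsi
  have e : ∀ u, ∑ f : Fib d, trK (psiK r L m) x u (Sum.inl β) f * X u w f b
      = ∑ l : Fin (d + 1), psiK r L m u x (Sum.inl l) (Sum.inl β) * X u w (Sum.inl l) b := by
    intro u
    rw [Fintype.sum_sum_type]
    simp only [trK_apply, psiK_inr_inl, zero_mul, Finset.sum_const_zero, add_zero]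
  simp_rw [e]
  exact Summable.tsum_finsetSum fun l _ => summable_psiK_mul hL hr m (fun u => X u w (Sum.inl l) b) x l β

omit hL hr in
/-- [folklore] LEFT MULTIPLIER LEG: the row is picked (`Ψ̂_m`'s multiplier block is the identity, its mixed blocks vanish). -/
theorem comp_trK_psiK_inr_left (X : MKer (d + 1) (Fib d)) (x w : Site (d + 1)) (μ : Fin (d + 1)) (b : Fib d) :
    comp (trK (psiK r L m)) X x w (Sum.inr μ) b = X x w (Sum.inr μ) b := by
  unfold ExpKernelCalculus.comp
  have e : ∀ u, ∑ f : Fib d, trK (psiK r L m) x u (Sum.inr μ) f * X u w f b = if x = u then X u w (Sum.inr μ) b else 0 := by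
    intro u
    rw [Fintype.sum_sum_type]
    simp only [trK_apply, psiK_inl_inr, zero_mul, Finset.sum_const_zero, zero_add, psiK_inr_inr]
    rw [Finset.sum_eq_single μ (fun μ' _ hμ' => by rw [if_neg (fun h => hμ' h.2), zero_mul]) (fun h => absurd (Finset.mem_univ μ) h)]
    by_cases hu : x = u
    · rw [if_pos ⟨hu.symm, rfl⟩, one_mul, if_pos hu]
    · rw [if_neg (fun h => hu h.1.symm), zero_mul, if_neg hu]
  simp_rw [e]
  exact tsum_point x _

/-- [folklore] **`Ψ̂_mᵀ` ACTS ON A COLUMN KERNEL BY THE SLOT TRANSPORT**: `comp (trK (psiK r L m)) (colK T w₀ b₀) = colK (slotPsi r L m T) w₀ b₀` — NO hypothesis on `T`. -/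
theorem comp_trK_psiK_colK (T : Form1 (d + 1) ℝ) (w₀ : Site (d + 1)) (b₀ : Fib d) :
    comp (trK (psiK r L m)) (colK T w₀ b₀) = colK (slotPsi r L m T) w₀ b₀ := by
  classical
  funext x w a b
  rcases a with β | μ
  · rw [comp_trK_psiK_inl_left hL hr m]
    by_cases h : w = w₀ ∧ b = b₀
    · obtain ⟨rfl, rfl⟩ := h
      have e : (fun κ u => colK T w b u w (Sum.inl κ) b) = T := by funext κ u; exact colK_apply_self T w b u κ
      rw [e, colK_apply_self]
    · have e : (fun κ u => colK T w₀ b₀ u w (Sum.inl κ) b) = 0 := by funext κ u; exact colK_of_ne T w₀ b₀ h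
      rw [e, slotPsi_zero, colK_of_ne _ w₀ b₀ h]; rfl
  · rw [comp_trK_psiK_inr_left, colK_inr, colK_inr]

end Legs

/-! ## §4 Bounds: bounded families stay bounded; the [S] socket -/

section Bounds

variable {L : ℕ} {r : ℕ → (Fin (d + 1) → ℕ)} {m : ℕ}

/-- [folklore] **BOUNDED SCALAR FAMILIES TRANSPORT TO BOUNDED FAMILIES**: `Decays Ψ̂_m C δ` (`0 < δ`) and `|T κ u| ≤ B` give
`|slotPsi r L m T β x| ≤ (d+1)·(C·Zl (d+1) δ·B)`. -/
theorem abs_slotPsi_le_of_bounded {C δ : ℝ} (hΨ : Decays (psiK r L m) C δ) (hδ : 0 < δ) {T : Form1 (d + 1) ℝ} {B : ℝ} (hB : ∀ κ u, |T κ u| ≤ B)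
    (β : Fin (d + 1)) (x : Site (d + 1)) :
    |slotPsi r L m T β x| ≤ ((d + 1 : ℕ) : ℝ) * (C * Zl (d + 1) δ * B) := by
  have hB0 : 0 ≤ B := (abs_nonneg _).trans (hB β x)
  have hl : ∀ l : Fin (d + 1), |∑' u : Site (d + 1), psiK r L m u x (Sum.inl l) (Sum.inl β) * T l u| ≤ C * Zl (d + 1) δ * B := by
    intro l
    have hs := (summable_exp_shift' hδ x).mul_left (C * B)
    have h := tsum_of_norm_bounded hs.hasSum (f := fun u : Site (d + 1) => psiK r L m u x (Sum.inl l) (Sum.inl β) * T l u) fun u => by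
      rw [Real.norm_eq_abs, abs_mul]
      calc |psiK r L m u x (Sum.inl l) (Sum.inl β)| * |T l u| ≤ (C * Real.exp (-δ * l1 (u - x))) * B :=
            mul_le_mul (hΨ u x (Sum.inl l) (Sum.inl β)) (hB l u) (abs_nonneg _) ((abs_nonneg _).trans (hΨ u x (Sum.inl l) (Sum.inl β)))
        _ = C * B * Real.exp (-δ * l1 (u - x)) := by ring
    rw [Real.norm_eq_abs] at h
    refine h.trans (le_of_eq ?_)
    rw [tsum_mul_left, tsum_exp_shift']
    ring
  unfold slotPsi
  calc |∑ l : Fin (d + 1), ∑' u : Site (d + 1), psiK r L m u x (Sum.inl l) (Sum.inl β) * T l u|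
      ≤ ∑ l : Fin (d + 1), |∑' u : Site (d + 1), psiK r L m u x (Sum.inl l) (Sum.inl β) * T l u| := Finset.abs_sum_le_sum_abs _ _
    _ ≤ ∑ _l : Fin (d + 1), C * Zl (d + 1) δ * B := Finset.sum_le_sum fun l _ => hl l
    _ = ((d + 1 : ℕ) : ℝ) * (C * Zl (d + 1) δ * B) := by rw [Finset.sum_const, Finset.card_univ, Fintype.card_fin, nsmul_eq_mul]

/-- [folklore] **THE [S] SOCKET: A LOCAL STENCIL FAMILY TRANSPORTS TO A LOCAL STENCIL FAMILY** — `Decays Ψ̂_m C δ` (`0 ≤ C`) and `LocStencil S Cs δ` (`0 < δ`, one common rate)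
give `LocStencil (slotPsiF r L m S) ((d+1)·(C·Cs·Zl (d+1) (δ/2))) (δ/2)` (`biLoc_wsum` with the decaying column of `Ψ̂_m` as weights, summed over the `d+1` slot directions). -/
theorem locStencil_slotPsiF {C δ : ℝ} (hΨ : Decays (psiK r L m) C δ) (hC : 0 ≤ C) {S : Fin (d + 1) → Site (d + 1) → MKer (d + 1) (Fib d)} {Cs : ℝ}
    (hS : LocStencil S Cs δ) (hδ : 0 < δ) :
    LocStencil (slotPsiF r L m S) (((d + 1 : ℕ) : ℝ) * (C * Cs * Zl (d + 1) (δ / 2))) (δ / 2) := by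
  intro κ u
  rw [slotPsiF_eq_sum_wsum]
  have hterm : ∀ l : Fin (d + 1), BiLoc (wsum (fun u' => psiK r L m u' u (Sum.inl l) (Sum.inl κ)) (S l)) u u (C * Cs * Zl (d + 1) (δ / 2)) (δ / 2) :=
    fun l => biLoc_wsum (fun u' => hΨ u' u _ _) (fun u' => hS l u') hδ hC
  have hsum := biLoc_finset_sum (Finset.univ : Finset (Fin (d + 1))) (fun l _ => hterm l)
  simp only [Finset.sum_const, Finset.card_univ, Fintype.card_fin, nsmul_eq_mul] at hsum
  exact hsum

/-- [folklore] The [S] socket, packaged: a local stencil family at any positive rate transports to a local stencil family (the decay of `Ψ̂_m` at that rate,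
`decays_psiK`). -/
theorem locStencil_slotPsiF' (hL : 0 < L) (hr : ∀ k, r k ∈ box (d + 1) L) {S : Fin (d + 1) → Site (d + 1) → MKer (d + 1) (Fib d)} {Cs δs : ℝ}
    (hS : LocStencil S Cs δs) (hδs : 0 < δs) : ∃ C' δ' : ℝ, 0 < δ' ∧ LocStencil (slotPsiF r L m S) C' δ' := by
  have hΨ := decays_psiK hL hr m hδs.le
  exact ⟨_, _, half_pos hδs, locStencil_slotPsiF hΨ (hΨ.nonneg (Sum.inl 0)) hS hδs⟩

end Bounds

/-! ## §5 The slot adjunction -/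

section Adjunction

variable {L : ℕ} (hL : 0 < L) {r : ℕ → (Fin (d + 1) → ℕ)} (hr : ∀ k, r k ∈ box (d + 1) L) (m : ℕ)
include hL hr

/-- [folklore] **THE SLOT ADJUNCTION AT `Ψ̂_m`, ENTRYWISE** (the sharp hypothesis, as leaf-03's: at the entry `(x, z, a, b)` the slot family `κ u ↦ S κ u x z a b` is localised
SOMEWHERE — `|S κ u x z a b| ≤ C·e^{−δ|u − p|₁}`, any centre `p`, `0 < δ`): for every spread `K` and every blocking `N` of the vertex,
`vertexOfK (Ψ̂_m ∘ K ∘ Ψ̂_mᵀ) N S μ y x z a b = vertexOfK K N (slotPsiF r L m S) μ y x z a b`.  ASSOCIATIVITY (`comp_assoc_tame` ×2 against `Loc (colK T)`),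
`comp_psiK_inr`, `comp_trK_psiK_colK`. -/
theorem vertexOfK_conj_psiK_apply {N : ℕ} {K : MKer (d + 1) (Fib d)} (hK : Spr K)
    (S : Fin (d + 1) → Site (d + 1) → MKer (d + 1) (Fib d)) (μ : Fin (d + 1)) (y x z : Site (d + 1)) (a b : Fib d)
    {p : Site (d + 1)} {C δ : ℝ} (hδ : 0 < δ) (hT : ∀ κ u, |S κ u x z a b| ≤ C * Real.exp (-δ * l1 (u - p))) :
    vertexOfK (comp (comp (psiK r L m) K) (trK (psiK r L m))) N S μ y x z a b = vertexOfK K N (slotPsiF r L m S) μ y x z a b := by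
  have hΨ : Spr (psiK r L m) := spr_psiK hL hr m
  have hK2 := hK
  obtain ⟨CK, δK, hδK, hKd⟩ := hK2
  have hK' : Spr (comp (comp (psiK r L m) K) (trK (psiK r L m))) := spr_comp (spr_comp hΨ hK) hΨ.trK
  obtain ⟨C', δ', hδ', hK'd⟩ := hK'
  have hC : 0 ≤ C := by
    have h := hT μ p
    rw [sub_self, show l1 (0 : Site (d + 1)) = 0 by simp [l1], mul_zero, Real.exp_zero, mul_one] at h
    exact (abs_nonneg _).trans h
  -- the scalar family at this entry: bounded by `C`, localised at `p`; its transport bounded (decay of `Ψ̂_m` at rate `1`)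
  have hB : ∀ κ u, |(fun κ u => S κ u x z a b) κ u| ≤ C := fun κ u =>
    (hT κ u).trans (by
      have : Real.exp (-δ * l1 (u - p)) ≤ 1 := by rw [Real.exp_le_one_iff]; nlinarith [l1_nonneg (u - p)]
      nlinarith)
  have hΨ1 := decays_psiK hL hr m (zero_le_one)
  obtain ⟨B', hB'⟩ : ∃ B' : ℝ, ∀ κ u, |slotPsiF r L m S κ u x z a b| ≤ B' :=
    ⟨_, fun κ u => by rw [slotPsiF_apply]; exact abs_slotPsi_le_of_bounded hΨ1 one_pos hB κ u⟩
  have hcol : Loc (colK (fun κ u => S κ u x z a b) z b) := loc_colK z b hC hδ hT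
  rw [vertexOfK_eq_comp_trK_colK hK'd hδ' x z a b hB μ y z b, vertexOfK_eq_comp_trK_colK hKd hδK x z a b hB' μ y z b]
  have eT : (fun κ u => slotPsiF r L m S κ u x z a b) = slotPsi r L m (fun κ u => S κ u x z a b) := by
    funext κ u; rfl
  rw [eT, ← comp_trK_psiK_colK hL hr m, trK_conj, ← comp_assoc_tame hΨ.tame (spr_comp hK.trK hΨ.trK).tame hcol.tame, comp_psiK_inr,
    ← comp_assoc_tame hK.trK.tame hΨ.trK.tame hcol.tame]

/-- [folklore] **THE SLOT ADJUNCTION AT `Ψ̂_m`** (S-an2-g49-1 §1 (B3)): for every spread `K`, every local stencil family `S` (`0 < δs`), every blocking `N` of the vertex,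
`vertexOfK (Ψ̂_m ∘ K ∘ Ψ̂_mᵀ) N S μ y = vertexOfK K N (slotPsiF r L m S) μ y` — the chain-rule vertex through the composite-corrected chart is the vertex through `K` of the
slot-transported family. -/
theorem vertexOfK_conj_psiK {N : ℕ} {K : MKer (d + 1) (Fib d)} (hK : Spr K)
    {S : Fin (d + 1) → Site (d + 1) → MKer (d + 1) (Fib d)} {Cs δs : ℝ} (hS : LocStencil S Cs δs) (hδs : 0 < δs) (μ : Fin (d + 1)) (y : Site (d + 1)) :
    vertexOfK (comp (comp (psiK r L m) K) (trK (psiK r L m))) N S μ y = vertexOfK K N (slotPsiF r L m S) μ y := by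
  funext x z a b
  exact vertexOfK_conj_psiK_apply hL hr m hK S μ y x z a b hδs (fun κ u => abs_stencil_le_exp_left hS hδs.le κ u x z a b)

/-- [folklore] **(T-col) THE `ℋ`-COLUMN OF A `Ψ̂_m`-CONJUGATE IS `Ψ_m` OF THE `ℋ`-COLUMN** — for ANY kernel `K` and blocking `N`:
`colH (Ψ̂_m ∘ K ∘ Ψ̂_mᵀ) N μ y = corrPsi r L m (colH K N μ y)` (K-U3d's apply bridges `comp_trK_psiK_inr`, `comp_psiK_inl`). -/
theorem colH_conj_psiK {N : ℕ} (K : MKer (d + 1) (Fib d)) (μ : Fin (d + 1)) (y : Site (d + 1)) :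
    colH (comp (comp (psiK r L m) K) (trK (psiK r L m))) N μ y = corrPsi r L m (colH K N μ y) := by
  funext κ' u
  show comp (comp (psiK r L m) K) (trK (psiK r L m)) u ((N : ℤ) • y) (Sum.inl κ') (Sum.inr μ) = _
  rw [comp_trK_psiK_inr, comp_psiK_inl hL hr m]
  rfl

end Adjunction

end Summit.QuantumFields.BalabanUV.Beta.CompositeCorrectorSlot

end
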